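import Summits.BirchSwinnertonDyer.BirchSwinnertonDyer.Theorems.PrintCf2RamifiedOffTYZSelmerRankOneSixGenus
import HarnessLib

/-!
# Crux `PrintCf2.RamifiedOffTYZOfFacts` (stmt-BirchSwinnertonDyer-20509), line `offtyz-v7`, LEAD cycle 10 (cruxlead-20509 g9):
# THE `s = 1`, `n ≡ 6 (mod 8)` STRATUM, GENUS FORM POINTED AT ONE PRIME (programme F3, part VII)

THEOREMS ONLY (no `def`, no named fact, no `sorry`), `--supports stmt-BirchSwinnertonDyer-20509`.  The genus form of the previous file asks the
class-number parity «`g(2d_S)` odd» of EVERY even block `2d_S ≡ 6 (mod 8)` of odd cofactor parity.  The mover argument only needs it for the blocks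
through ONE prime `pᵢ` at which the Selmer class `u = kerSum M_even` has `u_{inl i} = 1` (then the Kummer element pointed at `pᵢ` moves `P(n)`):
`rankOne_sha_bsdp_two_of_card_selmer_eight_six_genus_at`.  CENSUS (`instruments/census6_ispecific.py`, k ≤ 4, p < 48, s = 1 tuples 8/42/161/455):
all-blocks form 4/31/67/152, THIS pointed form 4/31/80/216, union with TYZ Thm 1.2 (`Σ₂′` odd) 8/42/135/348 = 100/100/84/76 %.
BSD is not proved by any of this; no class is closed by this file (a conditional result toward item 23432).

References: [cite: TianYuanZhang2017, Thm. 1.1, §3.1, Prop. 3.2 (2), Thm. 3.5, Thm. 3.6 (2), Lemma 3.18, proof of Lemma 3.21]; [cite: Smith2016CongruentDensity,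
§2 Table 1, Thm. 1.2]; [cite: LiMa2008, Thm. 0.4]; [cite: HeathBrown1994SelmerCongruentII, Appendix (Monsky), typescript p. 41 L20–L36].
-/

noncomputable section

open scoped Classical NumberField

open WeierstrassCurve WeierstrassCurve.Affine Finset Matrix Literature.NumberTheory.EllipticCurves
  Literature.NumberTheory.EllipticCurves.TianYuanZhang2017
  Literature.NumberTheory.EllipticCurves.TianYuanZhang2017.W2
  Literature.NumberTheory.EllipticCurves.HeathBrown1994
  Literature.NumberTheory.EllipticCurves.HeathBrown1994.Families
  Literature.NumberTheory.EllipticCurves.Smith2016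
  Literature.NumberTheory.EllipticCurves.MonskySelmerParity
  Literature.NumberTheory.QuadraticFields.RingClass
  Literature.NumberTheory.QuadraticFields
  Literature.LinearAlgebra.Matrix
  Summit.BirchSwinnertonDyer.Rank1Residual.P2.GenusPeriodTransferLayer
  Summit.BirchSwinnertonDyer.PrintCf2.QForm
  Summit.BirchSwinnertonDyer.PrintCf2.QFormForest

set_option autoImplicit false

namespace Summit.BirchSwinnertonDyer.PrintCf2.MoverAssembly

variable {k : ℕ} (p : Fin k → ℕ) (hp : ∀ i, (p i).Prime) (hodd : ∀ i, Odd (p i)) (hinj : Function.Injective p)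
variable {n : ℕ} (D : GenusPointData n)

include hp hodd hinj in
/-- **THE `s = 1` STRATUM FOR `n ≡ 6 (mod 8)`, GENUS FORM POINTED AT `pᵢ`.**  For `n = 2p₁⋯p_k` with `p₁⋯p_k ≡ 3 (mod 4)` and `#Sel⁽²⁾(E_n/ℚ) = 8`, granted
the printed TYZ §3 data (displays, `θ_d`, conductor-`4` Frobenius clause) and Thm 1.1: if the Selmer class `u = kerSum M_even` has `u_{inl i} = 1` and
`g(2d_S)` is ODD for every `S ∋ i` with `d_S ≡ 3 (mod 4)` and `coblockWeight p S = 1`, then `ord_{s=1} L(E_n, s) = 1`, `rank E_n(ℚ) = 1`,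
`Ш(E_n/ℚ)[2^∞] = 0`, and `BSD(E_n, 2)`. [cite: TianYuanZhang2017, Thm. 1.1, §3.1, Prop. 3.2 (2), Thm. 3.5, Thm. 3.6 (2), Lemma 3.18, proof of Lemma 3.21]
[cite: Smith2016CongruentDensity, §2 Table 1, Thm. 1.2] [cite: LiMa2008, Thm. 0.4] [cite: HeathBrown1994SelmerCongruentII, Appendix (Monsky), typescript p. 41 L20–L36] -/
theorem rankOne_sha_bsdp_two_of_card_selmer_eight_six_genus_at (hn : n = 2 * ∏ i, p i) (h3 : (∏ i, p i) % 4 = 3)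
    (hrec : D.recursion) (h35 : D.thm35Main) (hLs : D.scriptLSpec) (h318 : D.lemma318)
    (z : ℕ → APoint D.H) (Φ : ℕ → Finset (D.H ≃ₐ[ℚ] D.H)) (ΓH ΓH' : ℕ → Subgroup (D.H ≃ₐ[ℚ] D.H))
    (σ θ : ℕ → (D.H ≃ₐ[ℚ] D.H)) (c : D.H ≃ₐ[ℚ] D.H) (hc : D.ConjSpec c)
    (hblock : ∀ d ∈ n.divisors, ((d % 8 = 5 ∨ d % 8 = 6) → D.CMBlockSpec d (z d) (Φ d) (ΓH d) (ΓH' d) (σ d) c) ∧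
      (d % 8 = 7 → D.SevenBlockSpec d))
    (htheta : ∀ d ∈ n.divisors, d % 8 = 6 → D.ThetaBlockSpec d (z d) (ΓH d) (ΓH' d) (σ d) (θ d))
    (hFrob : ∀ d ∈ n.divisors, d % 8 = 6 → ∀ q : ℕ, q.Prime → q ∣ d → q ≠ 2 → ∃ φ : D.H ≃ₐ[ℚ] D.H,
      φ (D.sqrtNeg d) = D.sqrtNeg d ∧ φ * φ ∈ ΓH' d ∧ φ D.im = (jacobiSym (-1) q) • D.im ∧
        ∀ r : ℕ, r.Prime → r ∣ n → r ≠ q → φ (D.sqrtNeg r) = (jacobiSym (-(r : ℤ)) q) • D.sqrtNeg r)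
    (h11 : thm11_parity_of_scriptL) (i : Fin k) (hu : kerSum (monskyMatrixEven p) (Sum.inl i) = 1)
    (hgenus : ∀ S : Finset (Fin k), i ∈ S → (∑ j ∈ S, addLegendreSym (-1) (p j)) = 1 → coblockWeight p S = 1 → Odd (gK (2 * ∏ j ∈ S, p j)))
    (hsel : haveI := isElliptic_congruentNumberCurve (show n ≠ 0 by
        rw [hn]; exact mul_ne_zero two_ne_zero (Finset.prod_ne_zero_iff.mpr fun i _ => (hp i).ne_zero));
      Nat.card ((congruentNumberCurve n).selmerGroup 2) = 8) :
    haveI := isElliptic_congruentNumberCurve (show n ≠ 0 by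
      rw [hn]; exact mul_ne_zero two_ne_zero (Finset.prod_ne_zero_iff.mpr fun i _ => (hp i).ne_zero))
    (congruentNumberCurve n).analyticRank = 1 ∧ (congruentNumberCurve n).mordellWeilRank = 1 ∧
      AddCommGroup.primaryComponent (congruentNumberCurve n).sha 2 = ⊥ ∧
      BSDp (congruentNumberCurve n) 2 := by
  have hsel' : Nat.card ((congruentNumberCurve (2 * ∏ i, p i)).selmerGroup 2) = 8 := by subst hn; exact hsel
  have hadj : (monskyMatrixEven p).adjugate (Sum.inl i) (Sum.inr i) = 1 := by
    rw [adjugate_monskyEven_inl_inr_eq_kerSum p hp hodd hinj hsel' i, hu]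
  have hgenus' : ∀ S : Finset (Fin k), i ∈ S → (∑ j ∈ S, addLegendreSym (-1) (p j)) = 1 → coblockWeight p S = 1 →
      Odd (gK (2 * ∏ j ∈ S, p j)) ∧
        Fintype.card {v : Fin S.card ⊕ Unit → ZMod 2 //
          (Matrix.fromBlocks (legendreMatrix (blockPrimes p S) + legendreDiagonal (blockPrimes p S) (-2))
            (Matrix.of fun j (_ : Unit) => addLegendreSym 2 (blockPrimes p S j))
            (0 : Matrix Unit (Fin S.card) (ZMod 2)) (0 : Matrix Unit Unit (ZMod 2))) *ᵥ v = 0} = 2 := by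
    intro S hiS hS hcw
    have hg := hgenus S hiS hS hcw
    refine ⟨hg, ?_⟩
    have hS' : (∑ t, addLegendreSym (-1) (blockPrimes p S t)) = 1 := by
      rw [← hS]
      simp only [blockPrimes_apply]
      rw [← sum_coe_sort S]
      exact (S.orderIsoOfFin rfl).toEquiv.sum_comp (fun x : {x // x ∈ S} => addLegendreSym (-1) (p (x : Fin k)))
    have hg' : Odd (gK (2 * ∏ t, blockPrimes p S t)) := by rw [prod_blockPrimes]; exact hg
    exact card_ker_blockN_eq_two_of_odd_gK (blockPrimes p S) (blockPrimes_prime p hp S) (blockPrimes_odd p hodd S)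
      (blockPrimes_injective p hinj S) hS' hg'
  exact rankOne_sha_bsdp_two_of_card_selmer_eight_six p hp hodd hinj D hn h3 hrec h35 hLs h318 z Φ ΓH ΓH' σ θ c hc hblock htheta hFrob
    h11 i hgenus' hadj hsel

end Summit.BirchSwinnertonDyer.PrintCf2.MoverAssembly

end
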